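import Mathlib.RingTheory.SimpleModule.IsAlgClosed
import Mathlib.Analysis.Complex.Polynomial.Basic
import Mathlib.Algebra.QuaternionBasis
import Mathlib.LinearAlgebra.TensorProduct.Basis
import Mathlib.RingTheory.Flat.Basic
import Mathlib.Algebra.Algebra.Subalgebra.Centralizer
import Literature.NumberTheory.Automorphic.QuaternionAlgebraAdelicSplitProofs
import HarnessLib

/-!
# Classification of quaternion algebras over a number field: the uniqueness half

Companion file of `Literature.NumberTheory.Automorphic.QuaternionAlgebraAdelic` (namespace
`Literature.Automorphic`), working towards the named fact
`nonempty_algEquiv_of_ramifiedPlaces_eq K D` (Vignéras, LNM 800, Ch. III §3, Théorème 3.1,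
uniqueness: *two quaternion algebras over a number field with the same ramification are
isomorphic*).

The printed proof (Vignéras III §3, pp. 74–80) has the following architecture, which this file
reproduces one level deep:

1. **Local classification** (Ch. II §1, Théorème 1.1: *sur un corps local `K ≠ ℂ` il existe un unique
   corps de quaternions, à isomorphisme près*; for `K = ℝ` this is Frobenius' theorem, Ch. I §2
   Cor. 2.5; over `ℂ` every quaternion algebra is `M₂(ℂ)`, Ch. I §1 p. 3). Consequently *equal
   ramification* at a place `v` means `D_v ≃ D'_v`.
2. **Local–global principle** (Ch. III §3, Théorème 3.1 in its exact-sequence form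
   `1 → Quat(K) → ⊕_v Quat(K_v) → {±1} → 1`, exactness on the left = Propriété I
   "caractérisation des algèbres de matrices" + Théorème 3.8): `D ≃ D'` as soon as
   `D_v ≃ D'_v` for every place `v`.

Mathlib (pinned revision) has none of the main inputs (no Hasse principle, no local class field
theory, no Frobenius theorem: `rg` for `Hasse|Frobenius.*division`), but it has the
Wedderburn–Artin theorem (`IsSimpleRing.exists_algEquiv_matrix_divisionRing_finite`), the
centraliser of `1 ⊗ D` in `F ⊗_K D` (`Subalgebra.centralizer_range_includeRight_eq_center_tensorProduct`,
from which the packaged instance `Algebra.IsCentral F (F ⊗_K D)` is two steps away) and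
`K_w ≃+* ℝ` at the real places (`NumberField.InfinitePlace.Completion.ringEquivRealOfIsReal`).
From the sibling file `QuaternionAlgebraAdelicSplitProofs` we use the simplicity of `F ⊗_K D`
(`IsSimpleRing.tensorProduct_of_isCentral'`) and the discharge `isSplitAtInfinite_of_isComplex_holds`
(complex places are split).

What is **vendored as named facts** (each with its own cite; to be discharged bottom-up):

* `nonempty_algEquiv_adicCompletion_of_division` — uniqueness of the quaternion division algebra
  over the non-archimedean local fields `K_v` (Vignéras II §1 Thm. 1.1, Thm. 1.3);
* `nonempty_algEquiv_of_completions K D` — the local–global principle for isomorphism of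
  quaternion algebras (Vignéras III §3 Thm. 3.1, exactness of `1 → Quat(K) → ⊕_v Quat(K_v)`).
  A planned companion file (`QuaternionAlgebraHasse`) reduces it further to Cor. 3.4 (norm
  theorem) and Thm. 3.8 (common quadratic subfields).

What is **proved** here (plain theorems, no `Prop` wrappers):

* **base change** `isQuaternionAlgebra_scalarExtension` (Vignéras I §1 p. 3: `F ⊗_K D` is a
  quaternion algebra over `F`): central by `BaseChange.isCentral_baseChange` (from the Mathlib
  centraliser lemma), simple by `QuaternionAlgebraAdelicSplitProofs`, of dimension `4`;
* `IsQuaternionAlgebra.exists_algEquiv_divisionRing_or_split`, `division_or_split` — a quaternion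
  algebra is a division algebra or `M₂(K)` (Vignéras I §2 Cor. 2.4), from Wedderburn–Artin;
  `not_split_of_division` (the two cases exclude each other);
* **Frobenius' theorem** `Frobenius.nonempty_algEquiv_quaternion` (Vignéras I §2 Cor. 2.5: a
  non-commutative finite-dimensional division algebra over `ℝ` is `ℍ`), by the classical
  elementary argument (real quadratic equations from `Irreducible.natDegree_le_two`, an element
  `i` with `i² = -1`, its centraliser `ℝ + ℝ i`, an anticommuting `j`, the quaternionic basis
  `1, i, j, ij`);
* `nonempty_algEquiv_completion_of_isReal` — Vignéras II Thm. 1.1 at a real place, *derived* from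
  Frobenius' theorem by transport along `K_w ≃+* ℝ`;
* **`nonempty_algEquiv_of_ramifiedPlaces_eq_of_facts`** — the target named fact
  `nonempty_algEquiv_of_ramifiedPlaces_eq K D` follows from the two vendored inputs.

Remaining (later sessions): discharge the inputs (II Thm. 1.1 needs the valuation on `D_v` and the
structure of local fields; Thm. 3.1 needs Cor. 3.4, i.e. Hasse's norm theorem for quadratic
extensions, and Thm. 3.8), then `nonempty_algEquiv_of_ramifiedPlaces_eq_holds`.

## References

* M.-F. Vignéras, *Arithmétique des algèbres de quaternions*, LNM 800 (1980): Ch. I §1 p. 3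
  (produits tensoriels), §2 Cor. 2.4, Cor. 2.5 (Frobenius); Ch. II §1 Thm. 1.1, Thm. 1.3;
  Ch. III §3 Thm. 3.1, Propriété I, Thm. 3.8.
-/

noncomputable section

open scoped TensorProduct Quaternion
open NumberField IsDedekindDomain

universe u v

namespace Literature.NumberTheory.Automorphic

/-! ### Base change of a central algebra is central (Vignéras I §1 p. 3, "Produits tensoriels") -/

section

open TensorProduct

variable {K : Type*} [Field K] {D : Type*} [Ring D] [Algebra K D]

/-- **Base change preserves centrality**: for `D` central over the field `K` and any commutative
`K`-algebra `F`, the `F`-algebra `F ⊗_K D` is central (Vignéras I §1 p. 3 for quaternion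
algebras; classical for central simple algebras). Honest proof from Mathlib's computation of the
centraliser of `1 ⊗ D` in `F ⊗_K D` as `F ⊗ Z(D)`
(`Subalgebra.centralizer_range_includeRight_eq_center_tensorProduct`) and `Z(D) = K`: a central
element is a sum of `f ⊗ k·1 = (k f) ⊗ 1 ∈ F`. [folklore] -/
theorem BaseChange.isCentral_baseChange (F : Type*) [CommRing F] [Algebra K F]
    [Algebra.IsCentral K D] : Algebra.IsCentral F (F ⊗[K] D) where
  out := fun x hx ↦ by
    have hx' : x ∈ Subalgebra.centralizer K
        ((Algebra.TensorProduct.includeRight : D →ₐ[K] F ⊗[K] D).range : Set (F ⊗[K] D)) := by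
      rw [Subalgebra.mem_centralizer_iff]
      exact fun y _ ↦ Subalgebra.mem_center_iff.mp hx y
    rw [Subalgebra.centralizer_range_includeRight_eq_center_tensorProduct K F D] at hx'
    obtain ⟨y, hy⟩ := (AlgHom.mem_range _).mp hx'
    rw [← hy]
    clear hx hx' hy
    induction y using TensorProduct.induction_on with
    | zero => rw [map_zero]; exact zero_mem _
    | tmul f c =>
      obtain ⟨k, hk⟩ := (Algebra.IsCentral.mem_center_iff K).mp c.2
      refine Algebra.mem_bot.mpr ⟨k • f, ?_⟩
      rw [Algebra.TensorProduct.map_tmul, AlgHom.coe_id, id_eq, Subalgebra.coe_val, hk,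
        Algebra.TensorProduct.algebraMap_apply, Algebra.algebraMap_self_apply,
        Algebra.algebraMap_eq_smul_one, TensorProduct.smul_tmul]
    | add y z hy hz => rw [map_add]; exact add_mem hy hz

end

/-! ### Over a general field: Wedderburn, base change, Frobenius -/

section Field

variable (K : Type*) (D : Type u) [Field K] [Ring D] [Algebra K D]

/-- **Wedderburn form of Vignéras I §2 Cor. 2.4**: a quaternion algebra `D` over a field `K` is
either isomorphic (as a `K`-algebra) to a division ring, or to `M₂(K)`. Honest proof from Mathlib's
Wedderburn–Artin theorem: `D ≃ M_n(Δ)` with `Δ` a division algebra and `n² · dim_K Δ = 4`, so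
`n = 1` (and `D ≃ Δ`) or `n = 2` (and `Δ = K`). [cite: VignerasLNM800, Ch. I §2 Cor. 2.4] -/
theorem IsQuaternionAlgebra.exists_algEquiv_divisionRing_or_split [IsQuaternionAlgebra K D] :
    (∃ (Δ : Type u) (_ : DivisionRing Δ) (_ : Algebra K Δ), Nonempty (D ≃ₐ[K] Δ)) ∨
      Nonempty (D ≃ₐ[K] Matrix (Fin 2) (Fin 2) K) := by
  haveI := IsQuaternionAlgebra.isSimpleRing' K D
  haveI : IsArtinianRing D := IsArtinianRing.of_finite K D
  obtain ⟨n, hn, Δ, _, _, _, ⟨e⟩⟩ := IsSimpleRing.exists_algEquiv_matrix_divisionRing_finite K D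
  have hdim : Module.finrank K (Matrix (Fin n) (Fin n) Δ) = 4 := by
    rw [← e.toLinearEquiv.finrank_eq, IsQuaternionAlgebra.finrank_eq_four]
  rw [Module.finrank_matrix, Fintype.card_fin] at hdim
  have hpos : 0 < Module.finrank K Δ := Module.finrank_pos
  have hn0 : n ≠ 0 := hn.ne
  have hle : n ≤ 2 := by
    by_contra h
    have h3 : 3 ≤ n := by omega
    have : 3 * 3 * 1 ≤ n * n * Module.finrank K Δ :=
      Nat.mul_le_mul (Nat.mul_le_mul h3 h3) hpos
    omega
  interval_cases n
  · exact absurd rfl hn0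
  · -- `M₁(Δ) ≃ₐ[K] Δ`, written out (Mathlib's `Matrix.uniqueAlgEquiv` is stated for the
    -- `Unique`-derived `Fintype (Fin 1)` instance, which does not unify with `Fin.fintype 1`)
    let e₁ : Matrix (Fin 1) (Fin 1) Δ ≃ₐ[K] Δ :=
      { toFun := fun M ↦ M 0 0
        invFun := fun a ↦ Matrix.of fun _ _ ↦ a
        left_inv := fun M ↦ by ext i j; fin_cases i; fin_cases j; rfl
        right_inv := fun a ↦ rfl
        map_mul' := fun M N ↦ by simp [Matrix.mul_apply]
        map_add' := fun M N ↦ rfl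
        commutes' := fun k ↦ by simp [Matrix.algebraMap_matrix_apply] }
    exact Or.inl ⟨Δ, inferInstance, inferInstance, ⟨e.trans e₁⟩⟩
  · have h1 : Module.finrank K Δ = 1 := by omega
    have hb := Module.Free.bijective_algebraMap_of_finrank_eq_one h1
    let eΔ : K ≃ₐ[K] Δ := AlgEquiv.ofBijective (Algebra.ofId K Δ) hb
    exact Or.inr ⟨e.trans eΔ.symm.mapMatrix⟩

/-- **Vignéras I §2 Cor. 2.4** (*Caractérisation des algèbres de matrices*, first sentence): a
quaternion algebra over a field `K` is either a (skew) field or isomorphic to the matrix algebra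
`M₂(K)`. Honest proof (`exists_algEquiv_divisionRing_or_split`). [cite: VignerasLNM800, Ch. I §2 Cor. 2.4] -/
theorem IsQuaternionAlgebra.division_or_split [IsQuaternionAlgebra K D] :
    (∀ x : D, x ≠ 0 → IsUnit x) ∨ Nonempty (D ≃ₐ[K] Matrix (Fin 2) (Fin 2) K) := by
  refine (exists_algEquiv_divisionRing_or_split K D).imp (fun ⟨Δ, _, _, ⟨e⟩⟩ x hx ↦ ?_) id
  have hex : e x ≠ 0 := by simpa using hx
  simpa using (IsUnit.mk0 (e x) hex).map e.symm

omit [Algebra K D] in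
variable {D} in
/-- In `M₂(K)` the matrix unit `E₁₁` is a non-zero non-unit; hence a division algebra is not
isomorphic to `M₂(K)` (the two cases of Cor. 2.4 exclude each other). [folklore] -/
theorem IsQuaternionAlgebra.not_split_of_division [Algebra K D] (hdiv : ∀ x : D, x ≠ 0 → IsUnit x) :
    ¬ Nonempty (D ≃ₐ[K] Matrix (Fin 2) (Fin 2) K) := by
  rintro ⟨e⟩
  set E : Matrix (Fin 2) (Fin 2) K := !![1, 0; 0, 0] with hE
  have hE0 : E ≠ 0 := fun h ↦ by simpa [hE] using congr_fun (congr_fun h 0) 0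
  have hEu : ¬ IsUnit E := by
    rw [Matrix.isUnit_iff_isUnit_det, Matrix.det_fin_two_of]
    simp
  have hx : e.symm E ≠ 0 := by simpa using hE0
  exact hEu (by simpa using (hdiv _ hx).map e)

variable {D} in
/-- A division quaternion algebra is `K`-isomorphic to an honest `DivisionRing` (the `n = 1` case
of Wedderburn–Artin; used to feed Frobenius' theorem). [folklore] -/
theorem IsQuaternionAlgebra.exists_algEquiv_divisionRing [IsQuaternionAlgebra K D]
    (hdiv : ∀ x : D, x ≠ 0 → IsUnit x) :
    ∃ (Δ : Type u) (_ : DivisionRing Δ) (_ : Algebra K Δ), Nonempty (D ≃ₐ[K] Δ) :=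
  (exists_algEquiv_divisionRing_or_split K D).resolve_right (not_split_of_division K hdiv)

variable {D} in
/-- A quaternion algebra is not commutative (its centre is `K`, of dimension `1 ≠ 4`). [folklore] -/
theorem IsQuaternionAlgebra.exists_mul_ne_mul [IsQuaternionAlgebra K D] :
    ∃ x y : D, x * y ≠ y * x := by
  haveI : Nontrivial D := Module.nontrivial_of_finrank_pos (R := K)
    (by rw [IsQuaternionAlgebra.finrank_eq_four (K := K) (D := D)]; norm_num)
  by_contra h
  push Not at h
  have htop : (⊤ : Subalgebra K D) = ⊥ := by
    rw [← Algebra.IsCentral.center_eq_bot K D]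
    exact le_antisymm (fun x _ ↦ Subalgebra.mem_center_iff.mpr fun y ↦ h y x) le_top
  have h1 := Subalgebra.bot_eq_top_iff_finrank_eq_one.mp htop.symm
  rw [IsQuaternionAlgebra.finrank_eq_four (K := K) (D := D)] at h1
  exact absurd h1 (by norm_num)

/-- **Base change of quaternion algebras** (Vignéras I §1 p. 3, "Produits tensoriels": *le produit
tensoriel sur `K` d'une algèbre de quaternions `H/K` avec `F` est une algèbre de quaternions sur
`F`*): for every field extension `F` of `K`, `F ⊗_K D` (`ScalarExtension K F D`) is a quaternion
algebra over `F`, i.e. central (`BaseChange.isCentral_baseChange`), simple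
(`IsSimpleRing.tensorProduct_of_isCentral'` of `QuaternionAlgebraAdelicSplitProofs`, a field `F`
being simple) and of `F`-dimension `dim_K D = 4` (Mathlib `Module.finrank_baseChange`).
[cite: VignerasLNM800, Ch. I §1 p. 3] -/
theorem isQuaternionAlgebra_scalarExtension [IsQuaternionAlgebra K D] (F : Type*) [Field F]
    [Algebra K F] : IsQuaternionAlgebra F (ScalarExtension K F D) := by
  haveI := IsQuaternionAlgebra.isSimpleRing' K D
  exact
    { isCentral := (BaseChange.isCentral_baseChange F : Algebra.IsCentral F (F ⊗[K] D))
      isSimpleRing := (IsSimpleRing.tensorProduct_of_isCentral' : IsSimpleRing (F ⊗[K] D))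
      finrank_eq_four := by
        rw [show Module.finrank F (ScalarExtension K F D) = Module.finrank F (F ⊗[K] D) from rfl,
          Module.finrank_baseChange, IsQuaternionAlgebra.finrank_eq_four] }

end Field


/-! ### Frobenius' theorem (Vignéras I §2 Cor. 2.5), honest elementary proof

The classical argument (e.g. Palais' proof): every element of a finite-dimensional real division
algebra `A` satisfies a real quadratic equation (its minimal polynomial is irreducible over `ℝ`,
hence of degree `≤ 2`); a non-central element rescales to `i` with `i² = -1`; the centraliser of
`i` is `ℝ + ℝ i`; a commutator `i x - x i ≠ 0` anticommutes with `i` and rescales to `j` with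
`j² = -1`; then `1, i, j, ij` is a quaternionic basis spanning `A`, and the induced map
`ℍ[ℝ] → A` is bijective. -/

namespace Frobenius

variable {A : Type*} [DivisionRing A] [Algebra ℝ A]

/-- In a finite-dimensional division algebra over `ℝ` every element satisfies a real quadratic
equation `(x - a)² = c`: its minimal polynomial is irreducible (Mathlib `minpoly.irreducible`),
hence of degree `≤ 2` (Mathlib `Irreducible.natDegree_le_two`). [folklore] -/
theorem exists_sub_sq_eq [FiniteDimensional ℝ A] (x : A) :
    ∃ a c : ℝ, (x - a • 1) * (x - a • 1) = c • (1 : A) := by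
  have hx : IsIntegral ℝ x := Algebra.IsIntegral.isIntegral x
  have hirr : Irreducible (minpoly ℝ x) := minpoly.irreducible hx
  have hmo := minpoly.monic hx
  have hev := minpoly.aeval ℝ x
  have h2 := hirr.natDegree_le_two
  have h1 := hirr.natDegree_pos
  rw [Polynomial.aeval_eq_sum_range] at hev
  set p := minpoly ℝ x with hp
  interval_cases h : p.natDegree
  · -- degree 1: `x` is a real scalar
    have hc1 : p.coeff 1 = 1 := by simpa [h] using hmo.coeff_natDegree
    simp only [Finset.sum_range_succ, Finset.sum_range_zero, zero_add, pow_zero, pow_one,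
      hc1, one_smul] at hev
    refine ⟨-p.coeff 0, 0, ?_⟩
    have hx0 : x = (-p.coeff 0) • (1 : A) := by
      rw [neg_smul, eq_neg_iff_add_eq_zero, add_comm, hev]
    rw [hx0, sub_self, zero_mul, zero_smul]
  · -- degree 2: complete the square
    have hc2 : p.coeff 2 = 1 := by simpa [h] using hmo.coeff_natDegree
    simp only [Finset.sum_range_succ, Finset.sum_range_zero, zero_add, pow_zero, pow_one,
      hc2, one_smul] at hev
    refine ⟨-(p.coeff 1 / 2), (p.coeff 1 / 2) ^ 2 - p.coeff 0, ?_⟩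
    rw [sq] at hev
    simp only [mul_sub, sub_mul, mul_smul_comm, smul_mul_assoc, mul_one, one_mul]
    linear_combination (norm := module) hev

/-- If `z² = c` with `c ≥ 0` real then `z = ± √c` is a real scalar (`(z - √c)(z + √c) = 0` in a
division ring). [folklore] -/
theorem eq_smul_one_of_mul_self_eq {z : A} {c : ℝ} (hz : z * z = c • (1 : A)) (hc : 0 ≤ c) :
    z = (Real.sqrt c) • (1 : A) ∨ z = (-Real.sqrt c) • (1 : A) := by
  have hs : Real.sqrt c * Real.sqrt c = c := Real.mul_self_sqrt hc
  have hprod : (z - Real.sqrt c • (1 : A)) * (z + Real.sqrt c • (1 : A)) = 0 := by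
    simp only [sub_mul, mul_add, mul_smul_comm, smul_mul_assoc, mul_one, one_mul, hz]
    linear_combination (norm := module) (-hs) • (1 : A)
  rcases mul_eq_zero.mp hprod with h | h
  · exact Or.inl (sub_eq_zero.mp h)
  · exact Or.inr (by rw [neg_smul]; exact eq_neg_of_add_eq_zero_left h)

/-- If `z² = c` with `c < 0` real then `(√(-c))⁻¹ z` squares to `-1`. [folklore] -/
theorem smul_mul_smul_eq_neg_one {z : A} {c : ℝ} (hz : z * z = c • (1 : A)) (hc : c < 0) :
    ((Real.sqrt (-c))⁻¹ • z) * ((Real.sqrt (-c))⁻¹ • z) = -1 := by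
  have hs : Real.sqrt (-c) * Real.sqrt (-c) = -c := Real.mul_self_sqrt (by linarith)
  rw [smul_mul_smul_comm, hz, smul_smul, ← mul_inv, hs]
  rw [show ((-c)⁻¹ * c) = -1 by field_simp [hc.ne]]
  simp

/-- The centraliser of `i` (`i² = -1`) in a finite-dimensional real division algebra is
`ℝ + ℝ i`: if `y` commutes with `i` then `y = α + β i` (`y - a` squares to a real `c`; if `c ≥ 0`
it is real, if `c < 0` its rescaling `w` has `(w - i)(w + i) = 0`). [folklore] -/
theorem exists_eq_of_commute [FiniteDimensional ℝ A] {i : A} (hi : i * i = -1) {y : A}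
    (hy : y * i = i * y) : ∃ α β : ℝ, y = α • 1 + β • i := by
  obtain ⟨a, c, hz⟩ := exists_sub_sq_eq y
  set z := y - a • 1 with hzdef
  have hyz : y = z + a • 1 := by rw [hzdef, sub_add_cancel]
  rcases le_or_gt 0 c with hc | hc
  · rcases eq_smul_one_of_mul_self_eq hz hc with h | h
    · exact ⟨Real.sqrt c + a, 0, by rw [hyz, h, zero_smul, add_zero, add_smul]⟩
    · exact ⟨-Real.sqrt c + a, 0, by rw [hyz, h, zero_smul, add_zero, add_smul]⟩
  · set s := (Real.sqrt (-c))⁻¹ with hsdef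
    have hw : (s • z) * (s • z) = -1 := smul_mul_smul_eq_neg_one hz hc
    have hzi : z * i = i * z := by
      simp only [hzdef, sub_mul, mul_sub, smul_mul_assoc, mul_smul_comm, one_mul, mul_one, hy]
    have hprod : (s • z - i) * (s • z + i) = 0 := by
      rw [sub_mul, mul_add, mul_add, hw, hi, smul_mul_assoc, mul_smul_comm, hzi]; abel
    have hs0 : Real.sqrt (-c) ≠ 0 := by
      rw [Real.sqrt_ne_zero']; linarith
    have hzw : z = Real.sqrt (-c) • (s • z) := by
      rw [smul_smul, hsdef, mul_inv_cancel₀ hs0, one_smul]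
    rcases mul_eq_zero.mp hprod with h | h
    · refine ⟨a, Real.sqrt (-c), ?_⟩
      rw [hyz, hzw, sub_eq_zero.mp h, add_comm]
    · refine ⟨a, -Real.sqrt (-c), ?_⟩
      rw [hyz, hzw, eq_neg_of_add_eq_zero_left h, add_comm, smul_neg, neg_smul]

/-- A non-commutative finite-dimensional real division algebra contains `i` with `i² = -1`
(rescale a non-scalar element). [folklore] -/
theorem exists_mul_self_eq_neg_one [FiniteDimensional ℝ A] (hA : ∃ x y : A, x * y ≠ y * x) :
    ∃ i : A, i * i = -1 := by
  obtain ⟨x, hx⟩ : ∃ x : A, ∀ r : ℝ, x ≠ r • 1 := by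
    by_contra! h
    obtain ⟨x, y, hxy⟩ := hA
    obtain ⟨r, hr⟩ := h x
    exact hxy (by rw [hr, smul_mul_assoc, mul_smul_comm, one_mul, mul_one])
  obtain ⟨a, c, hz⟩ := exists_sub_sq_eq x
  rcases le_or_gt 0 c with hc | hc
  · exfalso
    rcases eq_smul_one_of_mul_self_eq hz hc with h | h
    · exact hx (Real.sqrt c + a) (by rw [add_smul, ← h, sub_add_cancel])
    · exact hx (-Real.sqrt c + a) (by rw [add_smul, ← h, sub_add_cancel])
  · exact ⟨_, smul_mul_smul_eq_neg_one hz hc⟩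

/-- Given `i` with `i² = -1` in a non-commutative finite-dimensional real division algebra, some
`x` does not commute with `i` (else `A = ℝ + ℝ i` would be commutative), and then
`j = i x - x i ≠ 0` anticommutes with `i`. [folklore] -/
theorem exists_anticommute [FiniteDimensional ℝ A] (hA : ∃ x y : A, x * y ≠ y * x) {i : A}
    (hi : i * i = -1) : ∃ j : A, j ≠ 0 ∧ j * i = -(i * j) := by
  obtain ⟨x, hx⟩ : ∃ x : A, x * i ≠ i * x := by
    by_contra! h
    obtain ⟨x, y, hxy⟩ := hA
    obtain ⟨α, β, rfl⟩ := exists_eq_of_commute hi (h x)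
    obtain ⟨γ, δ, rfl⟩ := exists_eq_of_commute hi (h y)
    apply hxy
    simp only [add_mul, mul_add, smul_mul_assoc, mul_smul_comm, one_mul, mul_one]
    module
  refine ⟨i * x - x * i, sub_ne_zero.mpr hx.symm, ?_⟩
  have h1 : (i * x - x * i) * i = i * x * i + x := by
    rw [sub_mul, mul_assoc x, hi]; noncomm_ring
  have h2 : i * (i * x - x * i) = -x - i * x * i := by
    rw [mul_sub, ← mul_assoc, hi]; noncomm_ring
  rw [h1, h2]; abel

/-- A non-zero `j` anticommuting with `i` (`i² = -1`) rescales to `j'` with `j'² = -1`, still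
anticommuting: from `(j - a)² = c`, the element `2a j` both commutes and anticommutes with `i`, so
`a = 0` and `j² = c`; `c ≥ 0` would make `j` central, so `c < 0`. [folklore] -/
theorem exists_anticommute_mul_self [FiniteDimensional ℝ A] {i : A} (hi : i * i = -1) {j : A}
    (hj0 : j ≠ 0) (hj : j * i = -(i * j)) :
    ∃ j' : A, j' * j' = -1 ∧ j' * i = -(i * j') := by
  have h20 : (2 : A) ≠ 0 := by
    rw [show (2 : A) = algebraMap ℝ A 2 by rw [map_ofNat]]
    exact (map_ne_zero_iff _ (algebraMap ℝ A).injective).mpr two_ne_zero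
  obtain ⟨a, c, hz⟩ := exists_sub_sq_eq j
  have hi0 : i ≠ 0 := by
    rintro rfl
    simp at hi
  have hjj : j * j * i = i * (j * j) := by
    rw [mul_assoc, hj, mul_neg, ← mul_assoc, hj, neg_mul, neg_neg, mul_assoc]
  have ha : a = 0 := by
    have hexp : (2 * a) • j = j * j + (a * a - c) • (1 : A) := by
      have := hz
      simp only [sub_mul, mul_sub, smul_mul_assoc, mul_smul_comm, one_mul, mul_one] at this
      linear_combination (norm := module) -this
    have hcomm : ((2 * a) • j) * i = i * ((2 * a) • j) := by
      rw [hexp, add_mul, mul_add, hjj, smul_mul_assoc, mul_smul_comm, one_mul, mul_one]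
    have hanti : ((2 * a) • j) * i = -(i * ((2 * a) • j)) := by
      rw [smul_mul_assoc, hj, mul_smul_comm, smul_neg]
    have h0 : i * ((2 * a) • j) = 0 := by
      have h2 : (2 : A) * (i * ((2 * a) • j)) = 0 := by
        rw [two_mul]; nth_rewrite 1 [← hcomm]; rw [hanti, neg_add_cancel]
      rcases mul_eq_zero.mp h2 with h | h
      · exact absurd h h20
      · exact h
    rw [mul_smul_comm, smul_eq_zero] at h0
    rcases h0 with h | h
    · linarith
    · exact absurd h (mul_ne_zero hi0 hj0)
  rw [ha, zero_smul, sub_zero] at hz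
  rcases le_or_gt 0 c with hc | hc
  · exfalso
    have hcen : j * i = i * j := by
      rcases eq_smul_one_of_mul_self_eq hz hc with h | h <;>
      · rw [h, smul_mul_assoc, mul_smul_comm, one_mul, mul_one]
    have h2 : (2 : A) * (i * j) = 0 := by
      rw [two_mul]; nth_rewrite 1 [← hcen]; rw [hj, neg_add_cancel]
    rcases mul_eq_zero.mp h2 with h | h
    · exact h20 h
    · exact mul_ne_zero hi0 hj0 h
  · refine ⟨(Real.sqrt (-c))⁻¹ • j, smul_mul_smul_eq_neg_one hz hc, ?_⟩
    rw [smul_mul_assoc, hj, mul_smul_comm, smul_neg]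

/-- A pair `i, j` with `i² = j² = -1`, `j i = -i j` is a quaternionic basis of type `(-1, 0, -1)`
(Mathlib `QuaternionAlgebra.Basis`, with `k = i j`). [folklore] -/
def quaternionBasis {i j : A} (hi : i * i = -1) (hj : j * j = -1) (hji : j * i = -(i * j)) :
    QuaternionAlgebra.Basis A (-1 : ℝ) 0 (-1) where
  i := i
  j := j
  k := i * j
  i_mul_i := by rw [hi, neg_smul, one_smul, zero_smul, add_zero]
  j_mul_j := by rw [hj, neg_smul, one_smul]
  i_mul_j := rfl
  j_mul_i := by rw [hji, zero_smul, zero_sub]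

/-- `A = ℝ + ℝ i + ℝ j + ℝ ij`: split `x` into its parts `(x ∓ i x i)/2` commuting, resp.
anticommuting, with `i`; the first lies in `ℝ + ℝ i`, and so does the second multiplied by `j`.
[folklore] -/
theorem exists_eq_combination [FiniteDimensional ℝ A] {i j : A} (hi : i * i = -1)
    (hj : j * j = -1) (hji : j * i = -(i * j)) (x : A) :
    ∃ r₀ r₁ r₂ r₃ : ℝ, x = r₀ • 1 + r₁ • i + r₂ • j + r₃ • (i * j) := by
  have h20 : (2 : ℝ) ≠ 0 := two_ne_zero
  set xp : A := (2 : ℝ)⁻¹ • (x - i * x * i) with hxp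
  set xm : A := (2 : ℝ)⁻¹ • (x + i * x * i) with hxm
  have hx : x = xp + xm := by
    rw [hxp, hxm, ← smul_add]
    rw [show x - i * x * i + (x + i * x * i) = (2 : ℝ) • x by rw [two_smul]; abel]
    rw [smul_smul, inv_mul_cancel₀ h20, one_smul]
  have hxpi : xp * i = i * xp := by
    simp only [hxp, smul_mul_assoc, mul_smul_comm, sub_mul, mul_sub]
    congr 1
    rw [mul_assoc (i * x) i i, hi, ← mul_assoc i (i * x), ← mul_assoc i i x, hi]
    noncomm_ring
  have hxmi : xm * i = -(i * xm) := by
    simp only [hxm, smul_mul_assoc, mul_smul_comm, add_mul, mul_add, ← smul_neg]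
    congr 1
    rw [mul_assoc (i * x) i i, hi, ← mul_assoc i (i * x), ← mul_assoc i i x, hi]
    noncomm_ring
  obtain ⟨α, β, hp⟩ := exists_eq_of_commute hi hxpi
  have hxmj : xm * j * i = i * (xm * j) := by
    rw [mul_assoc, hji, mul_neg, ← mul_assoc, hxmi, neg_mul, neg_neg, mul_assoc]
  obtain ⟨γ, δ, hm⟩ := exists_eq_of_commute hi hxmj
  have hxm' : xm = -(γ • j + δ • (i * j)) := by
    have : xm * j * j = -xm := by rw [mul_assoc, hj, mul_neg_one]
    calc xm = -(xm * j * j) := by rw [this, neg_neg]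
      _ = -(γ • j + δ • (i * j)) := by rw [hm, add_mul, smul_mul_assoc, smul_mul_assoc, one_mul]
  refine ⟨α, β, -γ, -δ, ?_⟩
  rw [hx, hp, hxm', neg_smul, neg_smul]
  abel

/-- **Frobenius' theorem** (Vignéras I §2 Cor. 2.5), honest proof: a non-commutative division ring
which is a finite-dimensional `ℝ`-algebra is `ℝ`-isomorphic to `ℍ[ℝ]` (the map `ℍ[ℝ] → A`
induced by the quaternionic basis `i, j, ij` is injective since `ℍ[ℝ]` is a division ring, and
surjective by `exists_eq_combination`). [cite: VignerasLNM800, Ch. I §2 Cor. 2.5] -/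
theorem nonempty_algEquiv_quaternion (A : Type*) [DivisionRing A] [Algebra ℝ A]
    [FiniteDimensional ℝ A] (hA : ∃ x y : A, x * y ≠ y * x) : Nonempty (A ≃ₐ[ℝ] ℍ[ℝ]) := by
  obtain ⟨i, hi⟩ := exists_mul_self_eq_neg_one hA
  obtain ⟨j₀, hj₀0, hj₀⟩ := exists_anticommute hA hi
  obtain ⟨j, hj, hji⟩ := exists_anticommute_mul_self hi hj₀0 hj₀
  let q := quaternionBasis hi hj hji
  have hinj : Function.Injective q.liftHom :=
    RingHom.injective (R := ℍ[ℝ]) (S := A) q.liftHom.toRingHom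
  have hsurj : Function.Surjective q.liftHom := fun x ↦ by
    obtain ⟨r₀, r₁, r₂, r₃, rfl⟩ := exists_eq_combination hi hj hji x
    refine ⟨⟨r₀, r₁, r₂, r₃⟩, ?_⟩
    simp only [QuaternionAlgebra.Basis.liftHom_apply, QuaternionAlgebra.Basis.lift,
      Algebra.algebraMap_eq_smul_one]
    rfl
  exact ⟨(AlgEquiv.ofBijective q.liftHom ⟨hinj, hsurj⟩).symm⟩

end Frobenius

/-! ### Local uniqueness at the places of a number field -/

section NumberField

variable (K : Type) [Field K] [NumberField K] (D : Type u) [Ring D] [Algebra K D]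

/-- **Uniqueness of the local quaternion division algebra** (Vignéras II §1 Thm. 1.1: *sur un corps
local `K ≠ ℂ` il existe un unique corps de quaternions, à isomorphisme près*; non-archimedean case
= Thm. 1.3, `H ≃ {L_nr, π}`), stated for the non-archimedean local fields that occur in Ch. III,
the completions `K_v` of a number field `K` at its finite places `v` (Mathlib
`IsDedekindDomain.HeightOneSpectrum.adicCompletion`; Mathlib's `IsNonarchimedeanLocalField` has no
instance on them at the pinned revision): two quaternion algebras over `K_v` which are division
rings are `K_v`-isomorphic. [cite: VignerasLNM800, Ch. II §1 Thm. 1.1] -/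
def nonempty_algEquiv_adicCompletion_of_division : Prop :=
  ∀ (K : Type) [Field K] [NumberField K] (v : HeightOneSpectrum (𝓞 K))
    (A : Type u) [Ring A] [Algebra (v.adicCompletion K) A]
    [IsQuaternionAlgebra (v.adicCompletion K) A]
    (B : Type v) [Ring B] [Algebra (v.adicCompletion K) B]
    [IsQuaternionAlgebra (v.adicCompletion K) B]
    (_hA : ∀ x : A, x ≠ 0 → IsUnit x) (_hB : ∀ x : B, x ≠ 0 → IsUnit x),
    Nonempty (A ≃ₐ[v.adicCompletion K] B)

omit [NumberField K] in
variable {K} in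
/-- **Frobenius at a real place, ring form**: a quaternion division
algebra `A` over the completion `K_w ≃ ℝ` at a real place `w` is ring-isomorphic to `ℍ[ℝ]`
compatibly with `K_w ≃+* ℝ` (Mathlib `Completion.ringEquivRealOfIsReal`). Honest proof: `A ≃ Δ`
a division ring (Wedderburn), restrict scalars along `ℝ ≃ K_w`, apply Frobenius.
(Vignéras II §1 Thm. 1.1, case `K = ℝ`.) [cite: VignerasLNM800, Ch. II §1 Thm. 1.1] -/
theorem exists_ringEquiv_quaternion_of_isReal {w : InfinitePlace K} (hw : w.IsReal) (A : Type u) [Ring A] [Algebra w.Completion A]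
    [IsQuaternionAlgebra w.Completion A] (hA : ∀ x : A, x ≠ 0 → IsUnit x) :
    ∃ g : A ≃+* ℍ[ℝ], ∀ x : w.Completion,
      g (algebraMap w.Completion A x) =
        algebraMap ℝ ℍ[ℝ] (InfinitePlace.Completion.ringEquivRealOfIsReal hw x) := by
  set e := InfinitePlace.Completion.ringEquivRealOfIsReal hw
  obtain ⟨Δ, _, _, ⟨eA⟩⟩ := IsQuaternionAlgebra.exists_algEquiv_divisionRing w.Completion hA
  -- restrict scalars along `e.symm : ℝ →+* K_w`
  letI : Algebra ℝ w.Completion := e.symm.toRingHom.toAlgebra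
  letI : Algebra ℝ Δ := Algebra.compHom Δ e.symm.toRingHom
  haveI : IsScalarTower ℝ w.Completion Δ :=
    ⟨fun r s x ↦ show (e.symm r * s) • x = e.symm r • s • x from mul_smul _ _ _⟩
  haveI : Module.Finite ℝ w.Completion :=
    Module.Finite.of_surjective (Algebra.linearMap ℝ w.Completion) e.symm.surjective
  haveI : Module.Finite w.Completion Δ := Module.Finite.equiv eA.toLinearEquiv
  haveI : FiniteDimensional ℝ Δ := Module.Finite.trans w.Completion Δ
  -- `Δ` is not commutative since `A` is central of dimension `4`
  have hnc : ∃ x y : Δ, x * y ≠ y * x := by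
    obtain ⟨x, y, hxy⟩ := IsQuaternionAlgebra.exists_mul_ne_mul (K := w.Completion) (D := A)
    exact ⟨eA x, eA y, fun h ↦ hxy (eA.injective (by simpa using h))⟩
  obtain ⟨f⟩ := Frobenius.nonempty_algEquiv_quaternion Δ hnc
  refine ⟨eA.toRingEquiv.trans f.toRingEquiv, fun x ↦ ?_⟩
  have hx : algebraMap w.Completion Δ x = algebraMap ℝ Δ (e x) := by
    show _ = algebraMap w.Completion Δ (e.symm (e x))
    rw [RingEquiv.symm_apply_apply]
  simp only [RingEquiv.coe_trans, Function.comp_apply, AlgEquiv.coe_ringEquiv, AlgEquiv.commutes]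
  rw [hx, AlgEquiv.commutes]

omit [NumberField K] in
variable {K} in
/-- **Vignéras II §1 Thm. 1.1 at a real place** (uniqueness of the quaternion division algebra
over `K_w ≃ ℝ`), *derived* from Frobenius' theorem: two quaternion division algebras over the
completion of a number field at a real place are isomorphic over `K_w`. Honest proof
(`exists_ringEquiv_quaternion_of_isReal` twice and `AlgEquiv.ofRingEquiv`). [cite: VignerasLNM800, Ch. II §1 Thm. 1.1] -/
theorem nonempty_algEquiv_completion_of_isReal {w : InfinitePlace K} (hw : w.IsReal)
    (A : Type u) [Ring A] [Algebra w.Completion A] [IsQuaternionAlgebra w.Completion A]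
    (B : Type v) [Ring B] [Algebra w.Completion B] [IsQuaternionAlgebra w.Completion B]
    (hA : ∀ x : A, x ≠ 0 → IsUnit x) (hB : ∀ x : B, x ≠ 0 → IsUnit x) :
    Nonempty (A ≃ₐ[w.Completion] B) := by
  obtain ⟨gA, hgA⟩ := exists_ringEquiv_quaternion_of_isReal hw A hA
  obtain ⟨gB, hgB⟩ := exists_ringEquiv_quaternion_of_isReal hw B hB
  refine ⟨AlgEquiv.ofRingEquiv (f := gA.trans gB.symm) fun x ↦ ?_⟩
  simp only [RingEquiv.coe_trans, Function.comp_apply, hgA]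
  rw [RingEquiv.symm_apply_eq, hgB]

/-! ### The local–global principle and the assembly -/

/-- **Local–global principle for quaternion algebras** (Vignéras III §3, Théorème 3.1 in its
exact-sequence form `1 → Quat(K) →ⁱ ⊕_v Quat(K_v) → {±1} → 1`, exactness at `Quat(K)`, i.e.
injectivity of `i : H ↦ (H_v)_v`; proved there from Propriété I — *`H ≅ M(2,K)` iff
`H_v ≅ M(2,K_v)` for every place `v`* — and Théorème 3.8): two quaternion algebras `D`, `D'`
over a number field `K` such that `D ⊗_K K_v ≃ D' ⊗_K K_v` over `K_v` for every finite place `v`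
and `D ⊗_K K_w ≃ D' ⊗_K K_w` over `K_w` for every infinite place `w` are isomorphic over `K`.
[cite: VignerasLNM800, Ch. III §3 Thm. 3.1] -/
def nonempty_algEquiv_of_completions : Prop :=
  ∀ (D' : Type*) [Ring D'] [Algebra K D'] [IsQuaternionAlgebra K D] [IsQuaternionAlgebra K D']
    (_hf : ∀ v : HeightOneSpectrum (𝓞 K),
      Nonempty (ScalarExtension K (v.adicCompletion K) D ≃ₐ[v.adicCompletion K]
        ScalarExtension K (v.adicCompletion K) D'))
    (_hi : ∀ w : InfinitePlace K,
      Nonempty (ScalarExtension K w.Completion D ≃ₐ[w.Completion]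
        ScalarExtension K w.Completion D')),
    Nonempty (D ≃ₐ[K] D')

/-- **Assembly (Vignéras III §3 Thm. 3.1, uniqueness, from its printed inputs).** The named fact
`nonempty_algEquiv_of_ramifiedPlaces_eq K D` — quaternion algebras over a number field with the
same finite and infinite ramification are isomorphic — follows from the local uniqueness at
finite places (`nonempty_algEquiv_adicCompletion_of_division`, II Thm. 1.1) and the local–global
principle (`nonempty_algEquiv_of_completions`, III Thm. 3.1), together with base change and
Frobenius' theorem proved above.
Proof: at each place both algebras are split (compose the two splittings) or both are non-split,
hence division algebras (Cor. 2.4, `division_or_split`), hence isomorphic (II Thm. 1.1 / Frobenius;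
complex places do not occur: `isSplitAtInfinite_of_isComplex_holds` of
`QuaternionAlgebraAdelicSplitProofs`); conclude by the
local–global principle. [cite: VignerasLNM800, Ch. III §3 Thm. 3.1] -/
theorem nonempty_algEquiv_of_ramifiedPlaces_eq_of_facts
    (hL : nonempty_algEquiv_adicCompletion_of_division.{u, v})
    (hH : nonempty_algEquiv_of_completions.{u, v} K D) :
    nonempty_algEquiv_of_ramifiedPlaces_eq.{u, v} K D := by
  intro D' _ _ _ _ hf hi
  refine hH D' (fun v ↦ ?_) (fun w ↦ ?_)
  · -- finite place `v`
    haveI : IsQuaternionAlgebra (v.adicCompletion K) (ScalarExtension K (v.adicCompletion K) D) :=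
      isQuaternionAlgebra_scalarExtension K D (v.adicCompletion K)
    haveI : IsQuaternionAlgebra (v.adicCompletion K) (ScalarExtension K (v.adicCompletion K) D') :=
      isQuaternionAlgebra_scalarExtension K D' (v.adicCompletion K)
    have hiff : ¬ IsSplitAt D v ↔ ¬ IsSplitAt D' v := by
      simpa only [mem_ramifiedPlaces_iff] using Set.ext_iff.mp hf v
    by_cases hv : IsSplitAt D v
    · obtain ⟨e'⟩ : IsSplitAt D' v := by
        by_contra h
        exact hiff.mpr h hv
      obtain ⟨e⟩ := hv
      exact ⟨e.trans e'.symm⟩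
    · have hv' : ¬ IsSplitAt D' v := hiff.mp hv
      have hdA := (IsQuaternionAlgebra.division_or_split (v.adicCompletion K)
        (ScalarExtension K (v.adicCompletion K) D)).resolve_right hv
      have hdB := (IsQuaternionAlgebra.division_or_split (v.adicCompletion K)
        (ScalarExtension K (v.adicCompletion K) D')).resolve_right hv'
      exact hL K v _ _ hdA hdB
  · -- infinite place `w`
    haveI : IsQuaternionAlgebra w.Completion (ScalarExtension K w.Completion D) :=
      isQuaternionAlgebra_scalarExtension K D w.Completion
    haveI : IsQuaternionAlgebra w.Completion (ScalarExtension K w.Completion D') :=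
      isQuaternionAlgebra_scalarExtension K D' w.Completion
    have hiff : ¬ IsSplitAtInfinite D w ↔ ¬ IsSplitAtInfinite D' w := by
      simpa only [mem_ramifiedInfinitePlaces_iff] using Set.ext_iff.mp hi w
    by_cases hw : IsSplitAtInfinite D w
    · obtain ⟨e'⟩ : IsSplitAtInfinite D' w := by
        by_contra h
        exact hiff.mpr h hw
      obtain ⟨e⟩ := hw
      exact ⟨e.trans e'.symm⟩
    · have hw' : ¬ IsSplitAtInfinite D' w := hiff.mp hw
      have hreal : w.IsReal := by
        by_contra hnr
        exact hw (isSplitAtInfinite_of_isComplex_holds D w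
          (InfinitePlace.not_isReal_iff_isComplex.mp hnr))
      have hdA := (IsQuaternionAlgebra.division_or_split w.Completion
        (ScalarExtension K w.Completion D)).resolve_right hw
      have hdB := (IsQuaternionAlgebra.division_or_split w.Completion
        (ScalarExtension K w.Completion D')).resolve_right hw'
      exact nonempty_algEquiv_completion_of_isReal hreal _ _ hdA hdB

end NumberField

end Literature.NumberTheory.Automorphic
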